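import Summits.CriticalPhenomena.CardyFormulaZ2.Theorems.CardySelfRefinementLagHandOffNoIdleAuxAlternation
import HarnessLib

/-!
# No one-sided touching of a fixed line by the limit interface, part 3: the one-sided
approach event

Helper file for the registered stubs `stub_quadTransfer_noTouchRe` / `stub_quadTransfer_noTouchIm`
of line `hitting-tournament` of crux `LagHandOff` (stmt-CriticalPhenomena-10268).  Fix a unit
vector `u`, a level `a` (the line `{z | Re (ū z) = a}`), an excursion size `d`, a closeness `ε`,
a radius `Rad` and a closed set `F` (the boundary).  A curve `c` APPROACHES THE LINE ONE-SIDEDLY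
if there are parameters `t₁ < t₂ < t₃` with `c t₂` within height `ε` of the line, `d`-far from
`c t₁` and from `c t₃`, `d`-far from `F`, of norm `< Rad`, and the whole arc `c[t₁, t₃]` of
height `< a + ε`.  This is the footprint, on one curve near a curve touching the line at an
interior point from the side `{Re (ū z) ≤ a}` while moving before and after, of that touch.
Written with STRICT inequalities the condition is open for the uniform distance up to
reparametrisation, hence a property of the curve CLASS and an open event of classes:

* `exists_forall_approaches_of_dist_lt` — stability under small reparametrisation distance
  (the arc condition passes to reparametrised nearby curves by compactness of `[t₁, t₃]`);
* `approaches_of_mk_eq` — invariance under change of representative;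
* `isOpen_setOf_exists_approaches` — the event of classes some representative of which
  approaches one-sidedly is open (no named definition is introduced: the event is written out);
* `approaches_reverse` — invariance under time reversal (the pattern is palindromic);
* `approaches_of_touch` — a curve touching the line `{Re (ū z) = a}` at a time `t` of a
  parameter interval on which it stays in `{Re (ū z) ≤ a}`, non-constant before and after `t`,
  with `c t` off `F` and of norm `< Rad`, approaches one-sidedly with excursion size `d` and
  closeness `ε` for all small `d` and ALL `ε > 0`.

References: G. F. Lawler, O. Schramm, W. Werner, Electron. J. Probab. 7 (2002), App. A;
M. Aizenman, A. Burchard, Duke Math. J. 99 (1999), §2.1 (the metric).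
-/

noncomputable section

open Set Filter Topology Metric
open scoped unitInterval
open Literature.Probability.Percolation Literature.Probability.RandomPlanarGeometry

namespace Summit.CriticalPhenomena.CardyFormulaZ2.Cruxes.LagHandOff.HittingTournament

/-! ### The one-sided approach pattern and its stability -/

/-- The height `Re (ū z)` is `1`-Lipschitz for a unit vector `u`. -/
theorem re_conj_mul_le_add_dist {u : ℂ} (hu : ‖u‖ = 1) (z z' : ℂ) :
    (starRingEnd ℂ u * z).re ≤ (starRingEnd ℂ u * z').re + dist z z' := by
  have h1 : (starRingEnd ℂ u * z).re - (starRingEnd ℂ u * z').re =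
      (starRingEnd ℂ u * (z - z')).re := by
    rw [← Complex.sub_re]; ring_nf
  have h2 : (starRingEnd ℂ u * (z - z')).re ≤ ‖starRingEnd ℂ u * (z - z')‖ := Complex.re_le_norm _
  rw [norm_mul, Complex.norm_conj, hu, one_mul, ← Complex.dist_eq] at h2
  linarith

/-- **Stability of the one-sided approach pattern under small reparametrisation distance.**
[cite: AizenmanBurchard1999, §2.1] -/
theorem exists_forall_approaches_of_dist_lt {c : Curve ℂ} {u : ℂ} (hu : ‖u‖ = 1)
    {a d ε Rad : ℝ} {F : Set ℂ}
    (h : ∃ t₁ t₂ t₃ : I, t₁ < t₂ ∧ t₂ < t₃ ∧ d < dist (c t₁) (c t₂) ∧ d < dist (c t₃) (c t₂) ∧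
      |(starRingEnd ℂ u * c t₂).re - a| < ε ∧ d < infDist (c t₂) F ∧ ‖c t₂‖ < Rad ∧
      ∀ r ∈ Icc t₁ t₃, (starRingEnd ℂ u * c r).re < a + ε) :
    ∃ η : ℝ, 0 < η ∧ ∀ c' : Curve ℂ, dist c c' < η →
      ∃ t₁ t₂ t₃ : I, t₁ < t₂ ∧ t₂ < t₃ ∧ d < dist (c' t₁) (c' t₂) ∧ d < dist (c' t₃) (c' t₂) ∧
        |(starRingEnd ℂ u * c' t₂).re - a| < ε ∧ d < infDist (c' t₂) F ∧ ‖c' t₂‖ < Rad ∧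
        ∀ r ∈ Icc t₁ t₃, (starRingEnd ℂ u * c' r).re < a + ε := by
  obtain ⟨t₁, t₂, t₃, h12, h23, h1, h3, h2, hF, hRad, harc⟩ := h
  -- the maximal height on the arc
  set f : I → ℝ := fun r => (starRingEnd ℂ u * c r).re with hf
  have hfc : Continuous f :=
    Complex.continuous_re.comp (continuous_const.mul c.continuous)
  have h13 : t₁ ≤ t₃ := (h12.trans h23).le
  obtain ⟨r₀, hr₀, hmax⟩ := (isCompact_Icc (a := t₁) (b := t₃)).exists_isMaxOn
    (nonempty_Icc.2 h13) hfc.continuousOn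
  have hM : f r₀ < a + ε := harc r₀ hr₀
  set η : ℝ := min (min ((dist (c t₁) (c t₂) - d) / 2) ((dist (c t₃) (c t₂) - d) / 2))
    (min (min (ε - |(starRingEnd ℂ u * c t₂).re - a|) (infDist (c t₂) F - d))
      (min (Rad - ‖c t₂‖) (a + ε - f r₀))) with hη
  have hηpos : 0 < η := by
    simp only [hη, lt_min_iff]
    exact ⟨⟨by linarith, by linarith⟩, ⟨by linarith, by linarith⟩, by linarith, by linarith⟩
  have hη1 : η ≤ (dist (c t₁) (c t₂) - d) / 2 := (min_le_left _ _).trans (min_le_left _ _)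
  have hη3 : η ≤ (dist (c t₃) (c t₂) - d) / 2 := (min_le_left _ _).trans (min_le_right _ _)
  have hη2 : η ≤ ε - |(starRingEnd ℂ u * c t₂).re - a| :=
    (min_le_right _ _).trans ((min_le_left _ _).trans (min_le_left _ _))
  have hηF : η ≤ infDist (c t₂) F - d :=
    (min_le_right _ _).trans ((min_le_left _ _).trans (min_le_right _ _))
  have hηR : η ≤ Rad - ‖c t₂‖ :=
    (min_le_right _ _).trans ((min_le_right _ _).trans (min_le_left _ _))
  have hηM : η ≤ a + ε - f r₀ :=
    (min_le_right _ _).trans ((min_le_right _ _).trans (min_le_right _ _))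
  refine ⟨η, hηpos, fun c' hcc' => ?_⟩
  obtain ⟨φ, hφ⟩ := Curve.exists_dist_reparam_lt hcc'
  have hclose : ∀ t : I, dist (c t) (c' (φ t)) < η := fun t => by
    have := ContinuousMap.dist_apply_le_dist (f := c.toContinuousMap)
      (g := (c'.reparam φ).toContinuousMap) (x := t)
    simp only [Curve.coe_toContinuousMap, Curve.reparam_apply] at this
    exact this.trans_lt hφ
  refine ⟨φ t₁, φ t₂, φ t₃, φ.lt_iff_lt.2 h12, φ.lt_iff_lt.2 h23, ?_, ?_, ?_, ?_, ?_, ?_⟩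
  · have := hclose t₁; have := hclose t₂
    linarith [dist_triangle4 (c t₁) (c' (φ t₁)) (c' (φ t₂)) (c t₂), dist_comm (c t₂) (c' (φ t₂))]
  · have := hclose t₃; have := hclose t₂
    linarith [dist_triangle4 (c t₃) (c' (φ t₃)) (c' (φ t₂)) (c t₂), dist_comm (c t₂) (c' (φ t₂))]
  · have ha := re_conj_mul_le_add_dist hu (c' (φ t₂)) (c t₂)
    have hb := re_conj_mul_le_add_dist hu (c t₂) (c' (φ t₂))
    have hc := hclose t₂
    rw [dist_comm] at ha
    have hAA : |(starRingEnd ℂ u * c' (φ t₂)).re - (starRingEnd ℂ u * c t₂).re| < η :=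
      abs_sub_lt_iff.2 ⟨by linarith, by linarith⟩
    calc |(starRingEnd ℂ u * c' (φ t₂)).re - a|
        ≤ |(starRingEnd ℂ u * c' (φ t₂)).re - (starRingEnd ℂ u * c t₂).re| +
            |(starRingEnd ℂ u * c t₂).re - a| := abs_sub_le _ _ _
      _ < ε := by linarith
  · have h1 : infDist (c t₂) F ≤ infDist (c' (φ t₂)) F + dist (c t₂) (c' (φ t₂)) :=
      infDist_le_infDist_add_dist
    linarith [hclose t₂]
  · have h1 := norm_le_norm_add_norm_sub' (c' (φ t₂)) (c t₂)
    rw [← dist_eq_norm, dist_comm] at h1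
    linarith [hclose t₂]
  · intro r' hr'
    set r := φ.symm r' with hr
    have hr'eq : φ r = r' := φ.apply_symm_apply r'
    have hrI : r ∈ Icc t₁ t₃ := by
      constructor
      · have := φ.symm.monotone hr'.1
        rwa [OrderIso.symm_apply_apply] at this
      · have := φ.symm.monotone hr'.2
        rwa [OrderIso.symm_apply_apply] at this
    have h1 := re_conj_mul_le_add_dist hu (c' (φ r)) (c r)
    have h2 := hclose r
    rw [dist_comm] at h2
    have h3 : f r ≤ f r₀ := hmax hrI
    rw [← hr'eq]
    simp only [hf] at h3
    linarith

/-- **The one-sided approach pattern is a property of the curve class.** -/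
theorem approaches_of_mk_eq {c c' : Curve ℂ} {u : ℂ} (hu : ‖u‖ = 1) {a d ε Rad : ℝ} {F : Set ℂ}
    (h : ∃ t₁ t₂ t₃ : I, t₁ < t₂ ∧ t₂ < t₃ ∧ d < dist (c t₁) (c t₂) ∧ d < dist (c t₃) (c t₂) ∧
      |(starRingEnd ℂ u * c t₂).re - a| < ε ∧ d < infDist (c t₂) F ∧ ‖c t₂‖ < Rad ∧
      ∀ r ∈ Icc t₁ t₃, (starRingEnd ℂ u * c r).re < a + ε)
    (hcc' : CurveClass.mk c = CurveClass.mk c') :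
    ∃ t₁ t₂ t₃ : I, t₁ < t₂ ∧ t₂ < t₃ ∧ d < dist (c' t₁) (c' t₂) ∧ d < dist (c' t₃) (c' t₂) ∧
      |(starRingEnd ℂ u * c' t₂).re - a| < ε ∧ d < infDist (c' t₂) F ∧ ‖c' t₂‖ < Rad ∧
      ∀ r ∈ Icc t₁ t₃, (starRingEnd ℂ u * c' r).re < a + ε := by
  obtain ⟨η, hη, hall⟩ := exists_forall_approaches_of_dist_lt hu h
  exact hall c' (by rw [CurveClass.mk_eq_mk_iff_dist_eq_zero.1 hcc']; exact hη)

/-- **The set of one-sidedly approaching curves is open** (reparametrisation pseudo-distance). -/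
theorem isOpen_setOf_approaches {u : ℂ} (hu : ‖u‖ = 1) (a d ε Rad : ℝ) (F : Set ℂ) :
    IsOpen {c : Curve ℂ | ∃ t₁ t₂ t₃ : I, t₁ < t₂ ∧ t₂ < t₃ ∧ d < dist (c t₁) (c t₂) ∧
      d < dist (c t₃) (c t₂) ∧ |(starRingEnd ℂ u * c t₂).re - a| < ε ∧ d < infDist (c t₂) F ∧
      ‖c t₂‖ < Rad ∧ ∀ r ∈ Icc t₁ t₃, (starRingEnd ℂ u * c r).re < a + ε} := by
  rw [Metric.isOpen_iff]
  intro c hc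
  obtain ⟨η, hη, hall⟩ := exists_forall_approaches_of_dist_lt hu hc
  exact ⟨η, hη, fun c' hc' => hall c' (by rw [dist_comm]; exact hc')⟩

/-! ### The one-sided approach event of curve classes -/

/-- **The one-sided approach event of curve classes is open** in `CurveClass ℂ`: the set of
classes some (equivalently, by `approaches_of_mk_eq`, every) representative of which approaches
the line one-sidedly is the image of an open set of curves under the open quotient map.
[cite: LawlerSchrammWernerEJP2002, Appendix A] -/
theorem isOpen_setOf_exists_approaches {u : ℂ} (hu : ‖u‖ = 1) (a d ε Rad : ℝ) (F : Set ℂ) :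
    IsOpen {γ : CurveClass ℂ | ∃ c : Curve ℂ, CurveClass.mk c = γ ∧
      ∃ t₁ t₂ t₃ : I, t₁ < t₂ ∧ t₂ < t₃ ∧ d < dist (c t₁) (c t₂) ∧ d < dist (c t₃) (c t₂) ∧
        |(starRingEnd ℂ u * c t₂).re - a| < ε ∧ d < infDist (c t₂) F ∧ ‖c t₂‖ < Rad ∧
        ∀ r ∈ Icc t₁ t₃, (starRingEnd ℂ u * c r).re < a + ε} := by
  have heq : {γ : CurveClass ℂ | ∃ c : Curve ℂ, CurveClass.mk c = γ ∧
      ∃ t₁ t₂ t₃ : I, t₁ < t₂ ∧ t₂ < t₃ ∧ d < dist (c t₁) (c t₂) ∧ d < dist (c t₃) (c t₂) ∧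
        |(starRingEnd ℂ u * c t₂).re - a| < ε ∧ d < infDist (c t₂) F ∧ ‖c t₂‖ < Rad ∧
        ∀ r ∈ Icc t₁ t₃, (starRingEnd ℂ u * c r).re < a + ε} =
      CurveClass.mk '' {c : Curve ℂ | ∃ t₁ t₂ t₃ : I, t₁ < t₂ ∧ t₂ < t₃ ∧
        d < dist (c t₁) (c t₂) ∧ d < dist (c t₃) (c t₂) ∧ |(starRingEnd ℂ u * c t₂).re - a| < ε ∧
        d < infDist (c t₂) F ∧ ‖c t₂‖ < Rad ∧
        ∀ r ∈ Icc t₁ t₃, (starRingEnd ℂ u * c r).re < a + ε} := by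
    ext γ
    simp only [mem_setOf_eq, mem_image]
    constructor
    · rintro ⟨c, hc, h⟩; exact ⟨c, h, hc⟩
    · rintro ⟨c, h, hc⟩; exact ⟨c, hc, h⟩
  rw [heq, CurveClass.mk_eq_separationQuotientMk]
  exact SeparationQuotient.isOpenMap_mk _ (isOpen_setOf_approaches hu a d ε Rad F)

/-- **The one-sided approach pattern is palindromic**: it passes to the time reversal. -/
theorem approaches_reverse {c : C(I, ℂ)} {u : ℂ} {a d ε Rad : ℝ} {F : Set ℂ}
    (h : ∃ t₁ t₂ t₃ : I, t₁ < t₂ ∧ t₂ < t₃ ∧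
      d < dist ((⟨c⟩ : Curve ℂ) t₁) ((⟨c⟩ : Curve ℂ) t₂) ∧
      d < dist ((⟨c⟩ : Curve ℂ) t₃) ((⟨c⟩ : Curve ℂ) t₂) ∧
      |(starRingEnd ℂ u * (⟨c⟩ : Curve ℂ) t₂).re - a| < ε ∧
      d < infDist ((⟨c⟩ : Curve ℂ) t₂) F ∧ ‖(⟨c⟩ : Curve ℂ) t₂‖ < Rad ∧
      ∀ r ∈ Icc t₁ t₃, (starRingEnd ℂ u * (⟨c⟩ : Curve ℂ) r).re < a + ε) :
    ∃ t₁ t₂ t₃ : I, t₁ < t₂ ∧ t₂ < t₃ ∧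
      d < dist ((⟨Interface.reverseCurve c⟩ : Curve ℂ) t₁) ((⟨Interface.reverseCurve c⟩ : Curve ℂ) t₂) ∧
      d < dist ((⟨Interface.reverseCurve c⟩ : Curve ℂ) t₃) ((⟨Interface.reverseCurve c⟩ : Curve ℂ) t₂) ∧
      |(starRingEnd ℂ u * (⟨Interface.reverseCurve c⟩ : Curve ℂ) t₂).re - a| < ε ∧
      d < infDist ((⟨Interface.reverseCurve c⟩ : Curve ℂ) t₂) F ∧ ‖(⟨Interface.reverseCurve c⟩ : Curve ℂ) t₂‖ < Rad ∧
      ∀ r ∈ Icc t₁ t₃, (starRingEnd ℂ u * (⟨Interface.reverseCurve c⟩ : Curve ℂ) r).re < a + ε := by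
  obtain ⟨t₁, t₂, t₃, h12, h23, h1, h3, h2, hF, hR, harc⟩ := h
  have hc : ∀ t, (⟨c⟩ : Curve ℂ) t = c t := fun t => rfl
  have hr : ∀ t, (⟨Interface.reverseCurve c⟩ : Curve ℂ) t = c (σ t) := fun t => rfl
  simp only [hc] at h1 h3 h2 hF hR harc
  refine ⟨σ t₃, σ t₂, σ t₁, unitInterval.symm_lt_symm.2 h23, unitInterval.symm_lt_symm.2 h12,
    ?_, ?_, ?_, ?_, ?_, ?_⟩
  · rw [hr, hr, unitInterval.symm_symm, unitInterval.symm_symm]; exact h3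
  · rw [hr, hr, unitInterval.symm_symm, unitInterval.symm_symm]; exact h1
  · rw [hr, unitInterval.symm_symm]; exact h2
  · rw [hr, unitInterval.symm_symm]; exact hF
  · rw [hr, unitInterval.symm_symm]; exact hR
  · intro r hrI
    rw [hr]
    refine harc (σ r) ⟨?_, ?_⟩
    · have := unitInterval.symm_le_symm.2 hrI.2
      rwa [unitInterval.symm_symm] at this
    · have := unitInterval.symm_le_symm.2 hrI.1
      rwa [unitInterval.symm_symm] at this

/-! ### A one-sided touch approaches at every closeness -/

/-- **A one-sided touch while moving before and after approaches one-sidedly at every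
closeness.** If on `[s, v]` the curve `c` stays in `{Re (ū z) ≤ a}`, touches the line
`{Re (ū z) = a}` at `t ∈ [s, v]`, is not constant on `[s, t]` nor on `[t, v]`, and `c t` is at
positive distance from `F` and of norm `< Rad`, then for some `d₀ > 0` the curve approaches the
line one-sidedly with excursion size `d` and closeness `ε` for all `0 < d ≤ d₀` and ALL `ε > 0`.
[cite: LawlerSchrammWernerEJP2002, Appendix A] -/
theorem approaches_of_touch {c : Curve ℂ} {u : ℂ} {a Rad : ℝ} {F : Set ℂ} {s t v : I}
    (hside : ∀ r ∈ Icc s v, (starRingEnd ℂ u * c r).re ≤ a)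
    (ht : (starRingEnd ℂ u * c t).re = a) (hns : ¬ ∀ r ∈ Icc s t, c r = c t)
    (hnv : ¬ ∀ r ∈ Icc t v, c r = c t) (hF : 0 < infDist (c t) F) (hRad : ‖c t‖ < Rad) :
    ∃ d₀ : ℝ, 0 < d₀ ∧ ∀ d : ℝ, 0 < d → d ≤ d₀ → ∀ ε : ℝ, 0 < ε →
      ∃ t₁ t₂ t₃ : I, t₁ < t₂ ∧ t₂ < t₃ ∧ d < dist (c t₁) (c t₂) ∧ d < dist (c t₃) (c t₂) ∧
        |(starRingEnd ℂ u * c t₂).re - a| < ε ∧ d < infDist (c t₂) F ∧ ‖c t₂‖ < Rad ∧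
        ∀ r ∈ Icc t₁ t₃, (starRingEnd ℂ u * c r).re < a + ε := by
  push Not at hns hnv
  obtain ⟨r₁, hr₁, hne₁⟩ := hns
  obtain ⟨r₂, hr₂, hne₂⟩ := hnv
  have hr₁t : r₁ < t := lt_of_le_of_ne hr₁.2 fun h => hne₁ (by rw [h])
  have htr₂ : t < r₂ := lt_of_le_of_ne hr₂.1 fun h => hne₂ (by rw [← h])
  have hd₁ : 0 < dist (c r₁) (c t) := dist_pos.2 hne₁
  have hd₂ : 0 < dist (c r₂) (c t) := dist_pos.2 hne₂
  set d₀ : ℝ := min (min (dist (c r₁) (c t)) (dist (c r₂) (c t))) (infDist (c t) F) / 2 with hd₀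
  have hd₀pos : 0 < d₀ := by
    rw [hd₀]; exact div_pos (lt_min (lt_min hd₁ hd₂) hF) two_pos
  refine ⟨d₀, hd₀pos, fun d' hd' hd'le ε hε => ⟨r₁, t, r₂, hr₁t, htr₂, ?_, ?_, ?_, ?_, hRad,
    fun r hr => ?_⟩⟩
  · have : d₀ < dist (c r₁) (c t) := by
      rw [hd₀]
      have := min_le_left (min (dist (c r₁) (c t)) (dist (c r₂) (c t))) (infDist (c t) F)
      have := min_le_left (dist (c r₁) (c t)) (dist (c r₂) (c t))
      linarith
    linarith
  · have : d₀ < dist (c r₂) (c t) := by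
      rw [hd₀]
      have := min_le_left (min (dist (c r₁) (c t)) (dist (c r₂) (c t))) (infDist (c t) F)
      have := min_le_right (dist (c r₁) (c t)) (dist (c r₂) (c t))
      linarith
    linarith
  · rw [ht, sub_self, abs_zero]; exact hε
  · have : d₀ < infDist (c t) F := by
      rw [hd₀]
      have := min_le_right (min (dist (c r₁) (c t)) (dist (c r₂) (c t))) (infDist (c t) F)
      linarith
    linarith
  · have := hside r ⟨hr₁.1.trans hr.1, hr.2.trans hr₂.2⟩
    linarith

/-- **Registered sub-stub `stub_noTouch_approachStable`** (line `hitting-tournament`, stubs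
`stub_quadTransfer_noTouchRe` / `stub_quadTransfer_noTouchIm`, helper 3): the stability lemma
`exists_forall_approaches_of_dist_lt` with all arguments explicit.
[cite: AizenmanBurchard1999, §2.1] -/
theorem stub_noTouch_approachStable : ∀ (c : Curve ℂ) (u : ℂ), ‖u‖ = 1 → ∀ (a d ε Rad : ℝ) (F : Set ℂ), (∃ t₁ t₂ t₃ : unitInterval, t₁ < t₂ ∧ t₂ < t₃ ∧ d < dist (c t₁) (c t₂) ∧ d < dist (c t₃) (c t₂) ∧ |(starRingEnd ℂ u * c t₂).re - a| < ε ∧ d < Metric.infDist (c t₂) F ∧ ‖c t₂‖ < Rad ∧ ∀ r ∈ Set.Icc t₁ t₃, (starRingEnd ℂ u * c r).re < a + ε) → ∃ η : ℝ, 0 < η ∧ ∀ c' : Curve ℂ, dist c c' < η → ∃ t₁ t₂ t₃ : unitInterval, t₁ < t₂ ∧ t₂ < t₃ ∧ d < dist (c' t₁) (c' t₂) ∧ d < dist (c' t₃) (c' t₂) ∧ |(starRingEnd ℂ u * c' t₂).re - a| < ε ∧ d < Metric.infDist (c' t₂) F ∧ ‖c' t₂‖ < Rad ∧ ∀ r ∈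 Set.Icc t₁ t₃, (starRingEnd ℂ u * c' r).re < a + ε :=
  fun _ _ hu _ _ _ _ _ h => exists_forall_approaches_of_dist_lt hu h

end Summit.CriticalPhenomena.CardyFormulaZ2.Cruxes.LagHandOff.HittingTournament

end
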